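import Mathlib
import Summits.Ventures.PercRepro2.HCovTyped

/-!
# The typed crux 2′TRI as a statement about exchangeable couplings of three copies
(blind cell PercRepro2, typer-1 g15, 2026-08-26)

Row 2′TRI (`CovForm.TypedBases`, `HCovTyped.lean`) says that every typed three-copy count of the
cubic kernel `K₃` is nonnegative: for every typed edge set `F`, pinning `z` off `F` and type map
`τ ∈ {1, 2}` on `F`, the sum of `K₃ x y w` over the triples of configurations agreeing with `z`
off `F` and carrying `e` in exactly `τ e` copies (`typedCount`) is `≥ 0`.  This file proves the
probabilistic reading recorded in the cell's S4 section (§2.3 «exchangeable-coupling form»):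

* an **edge-wise exchangeable coupling** of three copies is a product over the edges of laws
  `l e : Bool → Bool → Bool → R` on the three states of `e` that are nonnegative and invariant
  under permuting the copies (`IsExchangeable`);
  `exchExpect l K = ∑_{x,y,w} (∏_e l e (x e) (y e) (w e)) K x y w` is the expectation of `K`
  under it; the i.i.d. coupling `iid p` (`l e = p_e ⊗ p_e ⊗ p_e`) gives the weighted cubic form
  `triSum p ∅ τ K` (`exchExpect_iid`), hence (HCOV) is `0 ≤ exchExpect (iid p) K₃`
  (`HCov_iff_exchExpect_iid`, through `hcov_cubic`);
* every exchangeable edge law is a mixture of the four **typed laws** `nu k` (uniform on the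
  triples with exactly `k` open copies; `exchangeable_eq_sum_nu`), so by multilinearity
  `exchExpect l K` is a combination with nonnegative coefficients of the `exchExpect (nu ∘ τ) K`
  over the type maps `τ : E → Fin 4` (`exchExpect_eq_sum_types`), and each of those is a positive
  multiple of a typed count (`exchExpect_nu_eq_typedCount`: the typed set is `τ⁻¹{1, 2}`, the
  pinned configuration is `τ⁻¹{3}`);
* **`typedBases_iff_exchangeable`** : `TypedBases ends o a₁ a₂ a₃ b ↔`
  `∀ l, (∀ e a b c, 0 ≤ l e a b c) → (∀ e, IsExchangeable (l e)) → 0 ≤ exchExpect l K₃` —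
  row 2′TRI holds iff `K₃` has nonnegative expectation under EVERY edge-wise exchangeable
  coupling of three copies of the percolation process; the i.i.d. couplings alone are (HCOV)
  (`HCov_of_exchangeable` re-derives `HCov_of_typedBases`).

Own work; standard axioms.
-/

namespace Summit.Ventures.PercRepro2

namespace TriExchange

/-! ## Edge laws -/

section Laws

variable {R : Type*} [Field R] [LinearOrder R] [IsStrictOrderedRing R]

/-- The number of open copies among the three states `a b c` of an edge
(`= openCount x y w e` for `a = x e`, `b = y e`, `c = w e`). -/
def cnt (a b c : Bool) : ℕ := a.toNat + b.toNat + c.toNat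

/-- `cnt` is at most `3`. -/
lemma cnt_le_three (a b c : Bool) : cnt a b c ≤ 3 := by
  cases a <;> cases b <;> cases c <;> decide

/-- `cnt` is invariant under swapping the first two copies. -/
lemma cnt_swap₁ (a b c : Bool) : cnt a b c = cnt b a c := by
  unfold cnt; omega

/-- `cnt` is invariant under swapping the last two copies. -/
lemma cnt_swap₂ (a b c : Bool) : cnt a b c = cnt a c b := by
  unfold cnt; omega

/-- `cnt` as an element of `Fin 4`. -/
def cntFin (a b c : Bool) : Fin 4 := ⟨cnt a b c, Nat.lt_succ_of_le (cnt_le_three a b c)⟩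

/-- An edge law is **exchangeable** when it is invariant under permuting the three copies
(the two transpositions generate the symmetric group). -/
def IsExchangeable (l : Bool → Bool → Bool → R) : Prop :=
  ∀ a b c, l a b c = l b a c ∧ l a b c = l a c b

/-- The value of an exchangeable law on the orbit with `k` open copies. -/
def cval (l : Bool → Bool → Bool → R) : ℕ → R
  | 0 => l false false false
  | 1 => l true false false
  | 2 => l true true false
  | _ => l true true true

omit [Field R] [LinearOrder R] [IsStrictOrderedRing R] in
/-- An exchangeable law depends only on the number of open copies. -/
lemma exchangeable_eq_cval {l : Bool → Bool → Bool → R} (hl : IsExchangeable l) (a b c : Bool) :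
    l a b c = cval l (cnt a b c) := by
  have h1 : l false true false = l true false false := (hl false true false).1
  have h2 : l false false true = l false true false := (hl false false true).2
  have h3 : l true false true = l true true false := (hl true false true).2
  have h4 : l false true true = l true false true := (hl false true true).1
  cases a <;> cases b <;> cases c <;>
    first
    | rfl
    | exact h1
    | exact h2.trans h1
    | exact h3
    | exact h4.trans h3

omit [IsStrictOrderedRing R] in
/-- The orbit values of a nonnegative law are nonnegative. -/
lemma cval_nonneg {l : Bool → Bool → Bool → R} (hl : ∀ a b c, 0 ≤ l a b c) (n : ℕ) :
    0 ≤ cval l n := by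
  rcases n with _ | _ | _ | n
  · exact hl _ _ _
  · exact hl _ _ _
  · exact hl _ _ _
  · show 0 ≤ l true true true
    exact hl _ _ _

/-- The **typed law of type `k`**: the uniform law on the triples with exactly `k` open copies. -/
def nu (k : ℕ) (a b c : Bool) : R := if cnt a b c = k then 1 / (Nat.choose 3 k : R) else 0

/-- The typed laws are nonnegative. -/
lemma nu_nonneg (k : ℕ) (a b c : Bool) : 0 ≤ nu (R := R) k a b c := by
  unfold nu
  split_ifs
  · positivity
  · exact le_rfl

omit [LinearOrder R] [IsStrictOrderedRing R] in
/-- The typed laws are exchangeable. -/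
lemma nu_isExchangeable (k : ℕ) : IsExchangeable (nu (R := R) k) := by
  intro a b c
  refine ⟨?_, ?_⟩
  · unfold nu; rw [cnt_swap₁ a b c]
  · unfold nu; rw [cnt_swap₂ a b c]

omit [LinearOrder R] [IsStrictOrderedRing R] in
/-- The typed law of type `k : Fin 4`, as a point mass at the orbit `cntFin`. -/
lemma nu_eq (k : Fin 4) (a b c : Bool) :
    nu (R := R) k a b c = if k = cntFin a b c then 1 / (Nat.choose 3 (k : ℕ) : R) else 0 := by
  unfold nu
  have h : (k = cntFin a b c) ↔ (cnt a b c = k) := by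
    rw [Fin.ext_iff, eq_comm]
    exact Iff.rfl
  simp only [h]

/-- The mixture coefficients of an exchangeable law: `c k = C(3, k) · l(orbit k)`. -/
def coef (l : Bool → Bool → Bool → R) (k : Fin 4) : R := (Nat.choose 3 (k : ℕ) : R) * cval l k

/-- The mixture coefficients of a nonnegative law are nonnegative. -/
lemma coef_nonneg {l : Bool → Bool → Bool → R} (hl : ∀ a b c, 0 ≤ l a b c) (k : Fin 4) :
    0 ≤ coef l k :=
  mul_nonneg (by positivity) (cval_nonneg hl _)

/-- **Every exchangeable edge law is a mixture of the four typed laws**: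
`l a b c = ∑ k, coef l k · nu k a b c`. -/
lemma exchangeable_eq_sum_nu {l : Bool → Bool → Bool → R} (hl : IsExchangeable l) (a b c : Bool) :
    l a b c = ∑ k : Fin 4, coef l k * nu k a b c := by
  rw [exchangeable_eq_cval hl]
  simp_rw [nu_eq]
  simp only [mul_ite, mul_zero, Finset.sum_ite_eq', Finset.mem_univ, if_true]
  have hc : (Nat.choose 3 (cnt a b c) : R) ≠ 0 := by
    exact_mod_cast (Nat.choose_pos (cnt_le_three a b c)).ne'
  show cval l (cnt a b c) =
    (Nat.choose 3 (cnt a b c) : R) * cval l (cnt a b c) * (1 / (Nat.choose 3 (cnt a b c) : R))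
  field_simp

end Laws

/-! ## Product couplings and their expectations -/

section Expect

variable {R : Type*} [Field R] [LinearOrder R] [IsStrictOrderedRing R]
  {E : Type*} [Fintype E] [DecidableEq E]

/-- The expectation of `K` under the edge-wise product coupling with edge laws `l e`. -/
def exchExpect (l : E → Bool → Bool → Bool → R) (K : Config E → Config E → Config E → R) : R :=
  ∑ x : Config E, ∑ y : Config E, ∑ w : Config E, (∏ e, l e (x e) (y e) (w e)) * K x y w

/-- The edge-wise product of exchangeable laws expands over the type maps `τ : E → Fin 4`. -/
lemma prod_exchangeable_eq_sum (l : E → Bool → Bool → Bool → R) (hl : ∀ e, IsExchangeable (l e))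
    (x y w : Config E) :
    (∏ e, l e (x e) (y e) (w e)) =
      ∑ τ : E → Fin 4, (∏ e, coef (l e) (τ e)) * ∏ e, nu (τ e) (x e) (y e) (w e) := by
  calc (∏ e, l e (x e) (y e) (w e))
      = ∏ e, ∑ k : Fin 4, coef (l e) k * nu k (x e) (y e) (w e) :=
        Finset.prod_congr rfl fun e _ => exchangeable_eq_sum_nu (hl e) _ _ _
    _ = ∑ τ : E → Fin 4, ∏ e, coef (l e) (τ e) * nu (τ e) (x e) (y e) (w e) :=
        Fintype.prod_sum _
    _ = _ := by simp_rw [Finset.prod_mul_distrib]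

/-- **Multilinearity**: the expectation under exchangeable edge laws is the mixture, over the type
maps `τ : E → Fin 4`, of the expectations under the typed laws `nu (τ e)`, with the product
coefficients `∏ e, coef (l e) (τ e)`. -/
theorem exchExpect_eq_sum_types (l : E → Bool → Bool → Bool → R) (hl : ∀ e, IsExchangeable (l e))
    (K : Config E → Config E → Config E → R) :
    exchExpect l K =
      ∑ τ : E → Fin 4, (∏ e, coef (l e) (τ e)) * exchExpect (fun e => nu (τ e)) K := by
  unfold exchExpect
  simp_rw [prod_exchangeable_eq_sum l hl, Finset.sum_mul, Finset.mul_sum, mul_assoc]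
  exact CovForm.sum_comm4 _

/-! ## Typed laws and typed counts -/

/-- The typed set of a type map: the edges of type `1` or `2`. -/
def typedSet (τ : E → ℕ) : Finset E := Finset.univ.filter fun e => τ e = 1 ∨ τ e = 2

/-- The pinned configuration of a type map: open exactly at the edges of type `3`. -/
def pinned (τ : E → ℕ) : Config E := fun e => decide (τ e = 3)

omit [LinearOrder R] [IsStrictOrderedRing R] [DecidableEq E] in
/-- The product of the typed laws is a point mass on the triples with open counts `τ`. -/
lemma prod_nu_eq (τ : E → ℕ) (x y w : Config E) :
    (∏ e, nu (τ e) (x e) (y e) (w e) : R) =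
      if ∀ e, openCount x y w e = τ e then ∏ e, (1 / (Nat.choose 3 (τ e) : R)) else 0 := by
  unfold nu
  exact Fintype.prod_ite_zero

omit [DecidableEq E] in
/-- Off the typed set, «open count `τ e`» means «all three copies equal the pinned value». -/
lemma openCount_eq_iff_off (τ : E → ℕ) (hτ : ∀ e, τ e ≤ 3) (x y w : Config E) (e : E)
    (he : e ∉ typedSet τ) :
    openCount x y w e = τ e ↔ (x e = pinned τ e ∧ y e = pinned τ e ∧ w e = pinned τ e) := by
  have hne : ¬ (τ e = 1 ∨ τ e = 2) := by simpa [typedSet] using he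
  have h3 := hτ e
  unfold pinned openCount
  rcases (by omega : τ e = 0 ∨ τ e = 3) with h0 | h0 <;> rw [h0] <;>
    cases x e <;> cases y e <;> cases w e <;> simp

/-- The constraint «open counts `τ` everywhere» is the typed-count constraint of
`(typedSet τ, pinned τ, τ)`. -/
lemma forall_openCount_iff (τ : E → ℕ) (hτ : ∀ e, τ e ≤ 3) (x y w : Config E) :
    (∀ e, openCount x y w e = τ e) ↔
      ((∀ e, e ∉ typedSet τ → x e = pinned τ e ∧ y e = pinned τ e ∧ w e = pinned τ e) ∧
        ∀ e ∈ typedSet τ, openCount x y w e = τ e) := by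
  constructor
  · intro h
    exact ⟨fun e he => (openCount_eq_iff_off τ hτ x y w e he).1 (h e), fun e _ => h e⟩
  · rintro ⟨hoff, hon⟩ e
    by_cases he : e ∈ typedSet τ
    · exact hon e he
    · exact (openCount_eq_iff_off τ hτ x y w e he).2 (hoff e he)

omit [LinearOrder R] [IsStrictOrderedRing R] in
/-- **Typed expectations are typed counts**: under the typed laws `nu (τ e)` the expectation of
`K` is `∏ e, C(3, τ e)⁻¹` times the typed count of `K` on the typed set `τ⁻¹{1, 2}` with the
pinned configuration `τ⁻¹{3}`. -/
theorem exchExpect_nu_eq_typedCount (τ : E → ℕ) (hτ : ∀ e, τ e ≤ 3)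
    (K : Config E → Config E → Config E → R) :
    exchExpect (fun e => nu (τ e)) K =
      (∏ e, (1 / (Nat.choose 3 (τ e) : R))) * typedCount (typedSet τ) (pinned τ) τ K := by
  unfold exchExpect typedCount
  simp_rw [Finset.mul_sum]
  refine Finset.sum_congr rfl fun x _ => Finset.sum_congr rfl fun y _ =>
    Finset.sum_congr rfl fun w _ => ?_
  rw [prod_nu_eq, if_congr (forall_openCount_iff τ hτ x y w) rfl rfl]
  split_ifs <;> ring

omit [DecidableEq E] in
/-- The normalising constant of the typed laws is positive. -/
lemma prod_inv_choose_pos (τ : E → ℕ) (hτ : ∀ e, τ e ≤ 3) :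
    0 < ∏ e, (1 / (Nat.choose 3 (τ e) : R)) :=
  Finset.prod_pos fun e _ => one_div_pos.mpr (by exact_mod_cast Nat.choose_pos (hτ e))

/-! ## From a typed base `(F, z, τ)` to a type map -/

/-- The type map of a typed base: `τ` on `F`, and `3` / `0` off `F` according to `z`. -/
def extend (F : Finset E) (z : Config E) (τ : E → ℕ) : E → ℕ :=
  fun e => if e ∈ F then τ e else if z e then 3 else 0

omit [Fintype E] in
/-- `extend` agrees with `τ` on `F`. -/
lemma extend_of_mem {F : Finset E} {z : Config E} {τ : E → ℕ} {e : E} (he : e ∈ F) :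
    extend F z τ e = τ e := by
  simp [extend, he]

omit [Fintype E] in
/-- The type map of a typed base takes values in `{0, …, 3}` when `τ ∈ {1, 2}` on `F`. -/
lemma extend_le_three {F : Finset E} {z : Config E} {τ : E → ℕ}
    (hτ : ∀ e ∈ F, τ e = 1 ∨ τ e = 2) (e : E) : extend F z τ e ≤ 3 := by
  unfold extend
  by_cases he : e ∈ F
  · rcases hτ e he with h | h <;> simp [he, h]
  · cases z e <;> simp [he]

/-- The typed set of the extended type map is `F`. -/
lemma typedSet_extend {F : Finset E} {z : Config E} {τ : E → ℕ}
    (hτ : ∀ e ∈ F, τ e = 1 ∨ τ e = 2) : typedSet (extend F z τ) = F := by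
  ext e
  by_cases he : e ∈ F
  · simp [typedSet, extend, he, hτ e he]
  · rcases Bool.eq_false_or_eq_true (z e) with hz | hz <;> simp [typedSet, extend, he, hz]

omit [Fintype E] in
/-- The pinned configuration of the extended type map is `z` off `F`. -/
lemma pinned_extend_of_notMem {F : Finset E} {z : Config E} {τ : E → ℕ} {e : E} (he : e ∉ F) :
    pinned (extend F z τ) e = z e := by
  unfold pinned extend
  cases z e <;> simp [he]

omit [LinearOrder R] [IsStrictOrderedRing R] in
/-- The typed count of the typed base `(F, z, τ)` is the typed count of its type map. -/
lemma typedCount_extend (F : Finset E) (z : Config E) (τ : E → ℕ)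
    (K : Config E → Config E → Config E → R) :
    typedCount F (pinned (extend F z τ)) (extend F z τ) K = typedCount F z τ K := by
  unfold typedCount
  refine Finset.sum_congr rfl fun x _ => Finset.sum_congr rfl fun y _ =>
    Finset.sum_congr rfl fun w _ => ?_
  have hcond : ((∀ e, e ∉ F → x e = pinned (extend F z τ) e ∧ y e = pinned (extend F z τ) e ∧
        w e = pinned (extend F z τ) e) ∧ ∀ e ∈ F, openCount x y w e = extend F z τ e) ↔
      ((∀ e, e ∉ F → x e = z e ∧ y e = z e ∧ w e = z e) ∧ ∀ e ∈ F, openCount x y w e = τ e) := by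
    refine and_congr (forall_congr' fun e => imp_congr_right fun he => ?_)
      (forall₂_congr fun e he => ?_)
    · rw [pinned_extend_of_notMem he]
    · rw [extend_of_mem he]
  exact if_congr hcond rfl rfl

/-! ## The i.i.d. coupling -/

/-- The i.i.d. edge laws of the weight vector `p`: `p_e ⊗ p_e ⊗ p_e`. -/
def iid (p : E → R) (e : E) (a b c : Bool) : R :=
  edgeFactor (p e) a * edgeFactor (p e) b * edgeFactor (p e) c

omit [LinearOrder R] [IsStrictOrderedRing R] [Fintype E] [DecidableEq E] in
/-- The i.i.d. laws are exchangeable. -/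
lemma iid_isExchangeable (p : E → R) (e : E) : IsExchangeable (iid p e) := by
  intro a b c
  unfold iid
  constructor <;> ring

omit [Fintype E] [DecidableEq E] in
/-- The i.i.d. laws of an admissible weight vector are nonnegative. -/
lemma iid_nonneg (p : E → R) (hp : ∀ e, 0 ≤ p e ∧ p e ≤ 1) (e : E) (a b c : Bool) :
    0 ≤ iid p e a b c := by
  have h : ∀ d : Bool, 0 ≤ edgeFactor (p e) d := by
    intro d
    cases d
    · exact sub_nonneg.mpr (hp e).2
    · exact (hp e).1
  exact mul_nonneg (mul_nonneg (h a) (h b)) (h c)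

omit [LinearOrder R] [IsStrictOrderedRing R] in
/-- **The i.i.d. coupling gives the cubic form**: `exchExpect (iid p) K = triSum p ∅ τ K`. -/
theorem exchExpect_iid (p : E → R) (τ : E → ℕ) (K : Config E → Config E → Config E → R) :
    exchExpect (iid p) K = triSum p ∅ τ K := by
  rw [triSum_empty]
  unfold exchExpect iid weight
  simp_rw [Finset.prod_mul_distrib]

end Expect

/-! ## The crux -/

section Crux

variable {V : Type*} {E : Type*} [Fintype E] [DecidableEq E] [Fintype V] [DecidableEq V]
  {R : Type*} [Field R] [LinearOrder R] [IsStrictOrderedRing R]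

omit [Fintype V] [DecidableEq V] in
/-- **(HCOV) is the i.i.d. coupling**: `HCov p … ↔ 0 ≤ exchExpect (iid p) K₃`. -/
theorem HCov_iff_exchExpect_iid (p : E → R) (ends : E → Sym2 V) (o a₁ a₂ a₃ b : V) :
    CovForm.HCov p ends o a₁ a₂ a₃ b ↔
      0 ≤ exchExpect (iid p) (CovForm.K3 ends o a₁ a₂ a₃ b) := by
  unfold CovForm.HCov
  rw [CovForm.hcov_cubic p ends o a₁ a₂ a₃ b (fun _ => 0), exchExpect_iid p (fun _ => 0)]

omit [Fintype V] [DecidableEq V] in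
/-- **Row 2′TRI is the exchangeable-coupling inequality**: the typed bases of `K₃` are nonnegative
iff `K₃` has nonnegative expectation under every edge-wise exchangeable coupling of three copies. -/
theorem typedBases_iff_exchangeable (ends : E → Sym2 V) (o a₁ a₂ a₃ b : V) :
    CovForm.TypedBases (R := R) ends o a₁ a₂ a₃ b ↔
      ∀ l : E → Bool → Bool → Bool → R, (∀ e a b c, 0 ≤ l e a b c) →
        (∀ e, IsExchangeable (l e)) → 0 ≤ exchExpect l (CovForm.K3 ends o a₁ a₂ a₃ b) := by
  constructor
  · intro h l hl0 hl
    rw [exchExpect_eq_sum_types l hl]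
    refine Finset.sum_nonneg fun τ _ =>
      mul_nonneg (Finset.prod_nonneg fun e _ => coef_nonneg (hl0 e) _) ?_
    have hτ : ∀ e, ((τ e : ℕ)) ≤ 3 := fun e => Nat.lt_succ_iff.mp (τ e).isLt
    rw [exchExpect_nu_eq_typedCount (fun e => (τ e : ℕ)) hτ]
    refine mul_nonneg (prod_inv_choose_pos _ hτ).le ?_
    exact h _ _ _ fun e he => by simpa [typedSet] using he
  · intro h F z τ hτ
    have h3 := extend_le_three (z := z) hτ
    have key := h (fun e => nu (extend F z τ e)) (fun e a b c => nu_nonneg _ _ _ _)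
      (fun e => nu_isExchangeable _)
    rw [exchExpect_nu_eq_typedCount (extend F z τ) h3, typedSet_extend hτ, typedCount_extend,
      mul_nonneg_iff_of_pos_left (prod_inv_choose_pos _ h3)] at key
    exact key

omit [Fintype V] [DecidableEq V] in
/-- **(HCOV) from the exchangeable-coupling inequality** for every admissible weight vector
(the i.i.d. coupling is one exchangeable coupling; re-derives `HCov_of_typedBases`). -/
theorem HCov_of_exchangeable (ends : E → Sym2 V) (o a₁ a₂ a₃ b : V)
    (h : ∀ l : E → Bool → Bool → Bool → R, (∀ e a b c, 0 ≤ l e a b c) →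
      (∀ e, IsExchangeable (l e)) → 0 ≤ exchExpect l (CovForm.K3 ends o a₁ a₂ a₃ b))
    (p : E → R) (hp : IsProbVec p) : CovForm.HCov p ends o a₁ a₂ a₃ b :=
  (HCov_iff_exchExpect_iid p ends o a₁ a₂ a₃ b).2
    (h (iid p) (iid_nonneg p fun e => ⟨hp.nonneg e, hp.le_one e⟩) (iid_isExchangeable p))

end Crux

end TriExchange

end Summit.Ventures.PercRepro2
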